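import Literature.Analysis.FluidPDE.PeriodicLerayTransportIntegrability
import Literature.Analysis.FluidPDE.PeriodicLerayGradient
import Literature.Analysis.FluidPDE.SlicedLocalEnergy
import HarnessLib

/-!
# [BT1] §4 ¶1–3, the transport of suitable periodic weak solutions, IV: the local energy
  inequality (2.4) ⟹ (2.5) under the ansatz

Analysis/FluidPDE proof file (theorems only), fourth part of the discharge of the named fact
`Literature.Analysis.FluidPDE.bradshawTsai2017_ansatz_transport` (`PeriodicLeraySystem.lean`;
Bradshaw–Tsai, Ann. Henri Poincaré 18 (2017) = arXiv:1510.07504 [BT1], §4, proof of Thm 1.2),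
continuing `PeriodicLerayTransport`, `PeriodicLerayTransportGradient`,
`PeriodicLerayTransportIntegrability` and `PeriodicLerayGradient`.

[BT1] §4, last paragraph: "*Local energy inequality:* This property for `(v,π)` is inherited
from the suitability of `(u,p)` in the self-similar variables. Indeed, if we let
`φ(x,t) = ψ(y,s)/√(2t)` where `ψ(y,s)` is the test function in the local energy inequality (2.4)
for `(u,p)`, and note that `∂ₜφ(x,t) = (2t)^{-3/2}(∂ₛ − 1 − y·∇_y)ψ(y,s)`, we recover the local
energy inequality (1.5) for `(v,π)` with test function `φ`."

Read backwards (`ψ = eˢ φ ∘ Φ`, `Φ(s,y) = (e^{2s}/2, eˢy)`, `dt dx = e^{5s} ds dy`), the two sides of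
the Caffarelli–Kohn–Nirenberg inequality (2.5) for `v = u(y,s)/√(2t)`, `π = p(y,s)/(2t)`,
`∇v = (2t)⁻¹∇u` tested with `φ ≥ 0` are, term by term after the change of variables,
`2∫∫ |∇u|²ψ` and `∫∫ |u|²(∂ₛψ + Δψ) + |u|²((u − y)·∇ψ) + 2p(u·∇ψ) − |u|²ψ` (the `−1` above; the
terms `|u|² (eˢy)·∇_x` from `∂ₛ` and `−|u|² y·∇_y` cancel). This is twice (2.4) with the term
`∫∫ |u|²ψ ≥ 0` moved to the right-hand side, which is legitimate because every term is
integrable (`|u|², |u|³, p u, |∇u|² ∈ L¹_loc`, `PeriodicLerayTransportIntegrability`). This file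
proves exactly this:

* the chain rules for the weighted pull-back `ψ = eˢ φ ∘ Φ` (`timeDeriv`, `Δ`, `∇`) and the two
  **pointwise identities** of the pulled-back integrands
  (`simDensity_mul_dissipation_integrand`, `simDensity_mul_ckn_integrand`);
* `IsSuitablePeriodicWeakSolution.localEnergyInequality_phys`: for `(u,p)` suitable periodic with
  profile `U₀` under Assumption 2.1 (`T > 0`), **every** weak spatial gradient `H` of `u` on
  `ℝ × ℝ³` (they agree a.e. with the one of Def. 2.2), and every `φ ∈ C_c^∞((0,∞) × ℝ³)`,
  `φ ≥ 0`: `2 ∫∫ |physGradient H|² φ ≤ ∫∫ |v|²(∂ₜφ + Δφ) + (|v|² + 2π)(v·∇φ)` — the local energy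
  inequality of `IsSuitableWeakSolutionOn` (`ν = 1`, `f = 0`) for
  `(physVelocity u, physPressure p)`.

## References

* Z. Bradshaw, T.-P. Tsai, Ann. Henri Poincaré 18 (2017) = arXiv:1510.07504, Def. 2.3 (2.4), §4
  (proof of Thm 1.2, last paragraph) and Remark 4.1 [BradshawTsai2017AHP].
* L. Caffarelli, R. Kohn, L. Nirenberg, CPAM 35 (1982), (2.5) [CaffarelliKohnNirenberg1982].
-/

noncomputable section

open MeasureTheory TopologicalSpace Set Function Filter Topology Module Metric
open scoped InnerProductSpace RealInnerProductSpace ENNReal NNReal Laplacian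

namespace Literature.Analysis.FluidPDE

namespace BradshawTsai2017

variable {T : ℝ} {q : ℝ≥0∞}
  {U₀ u : ℝ → EuclideanSpace ℝ (Fin 3) → EuclideanSpace ℝ (Fin 3)}
  {p : ℝ → EuclideanSpace ℝ (Fin 3) → ℝ}

/-! ### The weighted pull-back `ψ = eˢ φ ∘ Φ` and its derivatives -/

section ChainRules

variable {φ : ℝ → EuclideanSpace ℝ (Fin 3) → ℝ}

/-- The test function `ψ(s,y) = eˢ φ(Φ(s,y))` of [BT1] §4 ("`φ(x,t) = ψ(y,s)/√(2t)`") is a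
space–time test function on `ℝ × ℝ³` when `φ ∈ C_c^∞((0,∞) × ℝ³)`. [cite: BradshawTsai2017AHP, §4 (proof of Thm 1.2)] -/
theorem isSpaceTimeTestOn_exp_mul_simPull
    (hφ : IsSpaceTimeTestOn (slab (EuclideanSpace ℝ (Fin 3)) (Ioi 0) isOpen_Ioi) φ) :
    IsSpaceTimeTestOn (⊤ : Opens (ℝ × EuclideanSpace ℝ (Fin 3)))
      (fun s y => Real.exp s * simPull φ s y) :=
  hφ.time_smul_simPull Real.contDiff_exp

/-- **Chain rule in time for `ψ = eˢ φ ∘ Φ`**: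
`∂ₛψ(s,y) = eˢ φ(Φ) + eˢ (e^{2s} ∂ₜφ(Φ) + D_xφ(Φ)[eˢy])` ([BT1] §4:
"`∂ₜφ = (2t)^{-3/2}(∂ₛ − 1 − y·∇_y)ψ`"). [cite: BradshawTsai2017AHP, §4 (proof of Thm 1.2)] -/
theorem timeDeriv_exp_mul_simPull
    (hφ : IsSpaceTimeTestOn (slab (EuclideanSpace ℝ (Fin 3)) (Ioi 0) isOpen_Ioi) φ) (s : ℝ)
    (y : EuclideanSpace ℝ (Fin 3)) :
    timeDeriv (fun s y => Real.exp s * simPull φ s y) s y =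
      Real.exp s * simPull φ s y + Real.exp s *
        (Real.exp (2 * s) * timeDeriv φ (simTime s) (Real.exp s • y) +
          fderiv ℝ (φ (simTime s)) (Real.exp s • y) (Real.exp s • y)) := by
  have hd : DifferentiableAt ℝ (uncurry φ) (simMap (s, y)) :=
    ((hφ.contDiff.differentiable (by simp)).differentiableAt)
  have hg : HasDerivAt (fun r => simPull φ r y) _ s := hasDerivAt_simPull hd.hasFDerivAt
  rw [timeDeriv_apply, deriv_fun_mul (Real.differentiableAt_exp) hg.differentiableAt, Real.deriv_exp,
    ← timeDeriv_apply (simPull φ) s y, timeDeriv_simPull hd]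
  rfl

/-- **Chain rule for the Laplacian of `ψ = eˢ φ ∘ Φ`**: `Δ_yψ(s,·)(y) = eˢ e^{2s} Δ_xφ(Φ(s,y))`. [folklore] -/
theorem laplacian_exp_mul_simPull
    (hφ : IsSpaceTimeTestOn (slab (EuclideanSpace ℝ (Fin 3)) (Ioi 0) isOpen_Ioi) φ) (s : ℝ)
    (y : EuclideanSpace ℝ (Fin 3)) :
    (Δ (fun y => Real.exp s * simPull φ s y)) y =
      Real.exp s * (Real.exp (2 * s) * (Δ (φ (simTime s))) (Real.exp s • y)) := by
  have h2 : ContDiff ℝ 2 (simPull φ s) := (hφ.simPull).contDiff_slice_two s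
  have e : (fun y => Real.exp s * simPull φ s y) = Real.exp s • simPull φ s := by
    funext y'; rfl
  rw [e, InnerProductSpace.laplacian_smul (Real.exp s) h2.contDiffAt, laplacian_simPull _ _ _
    (hφ.contDiff_slice_two _)]
  rfl

/-- **Chain rule for the gradient of `ψ = eˢ φ ∘ Φ`**: `∇_yψ(s,y) = eˢ eˢ ∇_xφ(Φ(s,y))`. [folklore] -/
theorem gradient_exp_mul_simPull
    (hφ : IsSpaceTimeTestOn (slab (EuclideanSpace ℝ (Fin 3)) (Ioi 0) isOpen_Ioi) φ) (s : ℝ)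
    (y : EuclideanSpace ℝ (Fin 3)) :
    gradient (fun y => Real.exp s * simPull φ s y) y =
      (Real.exp s * Real.exp s) • gradient (φ (simTime s)) (Real.exp s • y) := by
  have hd : DifferentiableAt ℝ (simPull φ s) y :=
    ((hφ.simPull.contDiff_slice s).differentiable (by simp)).differentiableAt
  unfold gradient
  rw [fderiv_const_mul hd, fderiv_simPull, smul_smul, map_smul]

end ChainRules

/-! ### The pointwise identities of the pulled-back integrands -/

/-- **The dissipation integrand**: `e^{5s} |∇_x v(Φ)|² φ(Φ) = |H|² ψ` for `∇_x v = physGradient H`,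
`ψ = eˢ φ ∘ Φ` (`|e^{-2s}H|² = e^{-4s}|H|²`). [cite: BradshawTsai2017AHP, §4 (proof of Thm 1.2)] -/
theorem simDensity_mul_dissipation_integrand
    (H : ℝ → EuclideanSpace ℝ (Fin 3) → EuclideanSpace ℝ (Fin 3) →L[ℝ] EuclideanSpace ℝ (Fin 3))
    (φ : ℝ → EuclideanSpace ℝ (Fin 3) → ℝ) (s : ℝ) (y : EuclideanSpace ℝ (Fin 3)) :
    (simDensity (EuclideanSpace ℝ (Fin 3)) (s, y) : ℝ) *
        (frobeniusNormSq (physGradient H (simTime s) (Real.exp s • y)) *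
          φ (simTime s) (Real.exp s • y)) =
      frobeniusNormSq (H s y) * (Real.exp s * simPull φ s y) := by
  have h5 : Real.exp (5 * s) = Real.exp s ^ 5 := by rw [← Real.exp_nat_mul]; norm_num
  have h2 : Real.exp (2 * s) = Real.exp s ^ 2 := by rw [← Real.exp_nat_mul]; norm_num
  rw [coe_simDensity_three, physGradient_simMap, frobeniusNormSq_smul, simPull_apply, h5, h2]
  have hE : Real.exp s ≠ 0 := (Real.exp_pos s).ne'
  field_simp

/-- **The Caffarelli–Kohn–Nirenberg integrand** ([BT1] §4, last paragraph, read backwards): with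
`v(Φ) = e^{-s}u`, `π(Φ) = e^{-2s}p`, `ψ = eˢ φ ∘ Φ`, for every `(s, y)`,
`e^{5s} [|v|²(∂ₜφ + Δφ) + (|v|² + 2π)(v·∇φ) + 2(0·v)φ](Φ(s,y))
  = 2 [½|u|²(∂ₛψ + Δψ) + ½|u|²((u − y)·∇ψ) + p(u·∇ψ)] − |u|²ψ`
(the `y·∇_y` terms produced by `∂ₛ(φ ∘ Φ)` and by `(u − y)·∇ψ` cancel; the `−|u|²ψ` is the `−1`
in "`∂ₜφ = (2t)^{-3/2}(∂ₛ − 1 − y·∇_y)ψ`"). [cite: BradshawTsai2017AHP, §4 (proof of Thm 1.2) and Remark 4.1] -/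
theorem simDensity_mul_ckn_integrand {φ : ℝ → EuclideanSpace ℝ (Fin 3) → ℝ}
    (hφ : IsSpaceTimeTestOn (slab (EuclideanSpace ℝ (Fin 3)) (Ioi 0) isOpen_Ioi) φ)
    (u : ℝ → EuclideanSpace ℝ (Fin 3) → EuclideanSpace ℝ (Fin 3))
    (p : ℝ → EuclideanSpace ℝ (Fin 3) → ℝ) (s : ℝ) (y : EuclideanSpace ℝ (Fin 3)) :
    (simDensity (EuclideanSpace ℝ (Fin 3)) (s, y) : ℝ) *
        (‖physVelocity u (simTime s) (Real.exp s • y)‖ ^ 2 *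
            (timeDeriv φ (simTime s) (Real.exp s • y) +
              1 * (Δ (φ (simTime s))) (Real.exp s • y)) +
          (‖physVelocity u (simTime s) (Real.exp s • y)‖ ^ 2 +
              2 * physPressure p (simTime s) (Real.exp s • y)) *
            ⟪physVelocity u (simTime s) (Real.exp s • y),
              gradient (φ (simTime s)) (Real.exp s • y)⟫ +
          2 * ⟪(0 : ℝ → EuclideanSpace ℝ (Fin 3) → EuclideanSpace ℝ (Fin 3)) (simTime s)
              (Real.exp s • y), physVelocity u (simTime s) (Real.exp s • y)⟫ *
            φ (simTime s) (Real.exp s • y)) =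
      2 * (‖u s y‖ ^ 2 / 2 *
          (timeDeriv (fun s y => Real.exp s * simPull φ s y) s y +
            (Δ (fun y => Real.exp s * simPull φ s y)) y) +
        (‖u s y‖ ^ 2 / 2 *
            ⟪u s y - y, gradient (fun y => Real.exp s * simPull φ s y) y⟫ +
          p s y * ⟪u s y, gradient (fun y => Real.exp s * simPull φ s y) y⟫)) -
        ‖u s y‖ ^ 2 * (Real.exp s * simPull φ s y) := by
  rw [timeDeriv_exp_mul_simPull hφ, laplacian_exp_mul_simPull hφ, gradient_exp_mul_simPull hφ,
    coe_simDensity_three, physVelocity_simMap, physPressure_simMap, simPull_apply]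
  -- the directional derivative along `x = eˢ y` is `eˢ ⟪∇φ, y⟫`
  have hL : fderiv ℝ (φ (simTime s)) (Real.exp s • y) (Real.exp s • y) =
      Real.exp s * ⟪y, gradient (φ (simTime s)) (Real.exp s • y)⟫ := by
    rw [map_smul, smul_eq_mul, real_inner_gradient_right]
  rw [hL]
  have h5 : Real.exp (5 * s) = Real.exp s ^ 5 := by rw [← Real.exp_nat_mul]; norm_num
  have h2 : Real.exp (2 * s) = Real.exp s ^ 2 := by rw [← Real.exp_nat_mul]; norm_num
  simp only [Pi.zero_apply, inner_zero_left, mul_zero, zero_mul, add_zero, norm_smul,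
    Real.norm_eq_abs, abs_inv, abs_of_pos (Real.exp_pos s), mul_pow, inner_sub_left,
    real_inner_smul_left, real_inner_smul_right, h5, h2]
  have hE : Real.exp s ≠ 0 := (Real.exp_pos s).ne'
  field_simp
  ring

/-! ### The integrable pieces -/

section Pieces

/-- **`|u|² u ∈ L¹_loc(ℝ × ℝ³)`** as a vector field (its norm is `|u|³ ∈ L¹_loc`,
`locallyIntegrable_norm_pow_three`): the field of the cubic flux `½|u|²(u·∇ψ)` of (2.4). [cite: BradshawTsai2017AHP, Def. 2.3 (2.4)] -/
theorem locallyIntegrable_norm_sq_smul (hT : 0 < T) (hA : ProfileAssumption T q U₀)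
    (hS : IsSuitablePeriodicWeakSolution T U₀ u p) :
    LocallyIntegrable
      (fun z : ℝ × EuclideanSpace ℝ (Fin 3) => ‖uncurry u z‖ ^ 2 • uncurry u z) volume := by
  have hum := hS.locallyIntegrable_uncurry.aestronglyMeasurable
  refine locallyIntegrable_iff.2 fun K hK => ?_
  have h3 := (locallyIntegrable_norm_pow_three hT hA hS).integrableOn_isCompact hK
  refine Integrable.mono' h3 ((hum.norm.pow 2).smul hum).restrict
    (Eventually.of_forall fun z => ?_)
  rw [norm_smul, Real.norm_eq_abs, abs_of_nonneg (sq_nonneg _)]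
  exact le_of_eq (by ring)

/-- **`p u ∈ L¹_loc(ℝ × ℝ³)`** as a vector field (its norm is `|p||u| ∈ L¹_loc`,
`locallyIntegrable_abs_mul_norm`): the field of the pressure flux `p(u·∇ψ)` of (2.4). [cite: BradshawTsai2017AHP, Def. 2.3 (2.4)] -/
theorem locallyIntegrable_pressure_smul (hT : 0 < T) (hA : ProfileAssumption T q U₀)
    (hS : IsSuitablePeriodicWeakSolution T U₀ u p) :
    LocallyIntegrable
      (fun z : ℝ × EuclideanSpace ℝ (Fin 3) => uncurry p z • uncurry u z) volume := by
  have hum := hS.locallyIntegrable_uncurry.aestronglyMeasurable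
  have hpm := hS.locallyIntegrable_pressure.aestronglyMeasurable
  refine locallyIntegrable_iff.2 fun K hK => ?_
  have h := (locallyIntegrable_abs_mul_norm hT hA hS).integrableOn_isCompact hK
  refine Integrable.mono' h (hpm.smul hum).restrict (Eventually.of_forall fun z => ?_)
  rw [norm_smul, Real.norm_eq_abs]

/-- `|∇u|² ∈ L¹_loc(ℝ × ℝ³)` for the weak gradient of Definition 2.2, as a real function. [cite: BradshawTsai2017AHP, Def. 2.2] -/
theorem locallyIntegrable_frobeniusNormSq (hT : 0 < T) (hA : ProfileAssumption T q U₀)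
    (hS : IsSuitablePeriodicWeakSolution T U₀ u p)
    {G : ℝ → EuclideanSpace ℝ (Fin 3) → EuclideanSpace ℝ (Fin 3) →L[ℝ] EuclideanSpace ℝ (Fin 3)}
    (hG : HasWeakSpatialGradientOn (⊤ : Opens (ℝ × EuclideanSpace ℝ (Fin 3))) u G)
    (hGL2 : ∫⁻ z in Ioo 0 T ×ˢ (univ : Set (EuclideanSpace ℝ (Fin 3))),
      ENNReal.ofReal (frobeniusNormSq (G z.1 z.2 - fderiv ℝ (U₀ z.1) z.2)) < ∞) :
    LocallyIntegrable
      (fun z : ℝ × EuclideanSpace ℝ (Fin 3) => frobeniusNormSq (G z.1 z.2)) volume := by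
  have h := locallyIntegrableOn_frobeniusNormSq hG fun K _ hK =>
    setLIntegral_frobeniusNormSq_lt_top_of_isCompact hT hA hS hG hGL2 hK
  rwa [Opens.coe_top, locallyIntegrableOn_univ] at h

variable {φ : ℝ → EuclideanSpace ℝ (Fin 3) → ℝ}

/-- A locally integrable scalar times the weighted pull-back `ψ = eˢ φ ∘ Φ` is integrable. [folklore] -/
theorem integrable_mul_psi {F : ℝ × EuclideanSpace ℝ (Fin 3) → ℝ} (hF : LocallyIntegrable F volume)
    (hφ : IsSpaceTimeTestOn (slab (EuclideanSpace ℝ (Fin 3)) (Ioi 0) isOpen_Ioi) φ) :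
    Integrable (fun z : ℝ × EuclideanSpace ℝ (Fin 3) =>
      F z * (Real.exp z.1 * simPull φ z.1 z.2)) volume := by
  have hψt := isSpaceTimeTestOn_exp_mul_simPull hφ
  exact integrable_mul_of_locallyIntegrableOn (Q := ⊤) (hF.locallyIntegrableOn _)
    hψt.contDiff.continuous hψt.hasCompactSupport (fun _ _ => trivial) fun z hz =>
      show uncurry (fun s y => Real.exp s * simPull φ s y) z = 0 from
        image_eq_zero_of_notMem_tsupport hz

/-- **The integrand of (2.4) tested with `ψ = eˢ φ ∘ Φ` is integrable on `ℝ × ℝ³`** (its four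
terms `½|u|²(∂ₛψ + Δψ)`, `½|u|²(u·∇ψ)`, `−½|u|²(y·∇ψ)`, `p(u·∇ψ)` are locally integrable fields
against continuous compactly supported coefficients). [cite: BradshawTsai2017AHP, Def. 2.3 (2.4)] -/
theorem integrable_localEnergy_integrand (hT : 0 < T) (hA : ProfileAssumption T q U₀)
    (hS : IsSuitablePeriodicWeakSolution T U₀ u p)
    (hφ : IsSpaceTimeTestOn (slab (EuclideanSpace ℝ (Fin 3)) (Ioi 0) isOpen_Ioi) φ) :
    Integrable (fun z : ℝ × EuclideanSpace ℝ (Fin 3) =>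
      ‖u z.1 z.2‖ ^ 2 / 2 *
          (timeDeriv (fun s y => Real.exp s * simPull φ s y) z.1 z.2 +
            (Δ (fun y => Real.exp z.1 * simPull φ z.1 y)) z.2) +
        (‖u z.1 z.2‖ ^ 2 / 2 *
            ⟪u z.1 z.2 - z.2, gradient (fun y => Real.exp z.1 * simPull φ z.1 y) z.2⟫ +
          p z.1 z.2 * ⟪u z.1 z.2, gradient (fun y => Real.exp z.1 * simPull φ z.1 y) z.2⟫))
      volume := by
  have hψt := isSpaceTimeTestOn_exp_mul_simPull hφ
  have hU : Continuous (uncurry U₀) := hA.contDiff.continuous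
  set K := tsupport (uncurry fun s y => Real.exp s * simPull φ s y) with hK
  have hKc : IsCompact K := hψt.hasCompactSupport
  have hKQ : K ⊆ ((⊤ : Opens (ℝ × EuclideanSpace ℝ (Fin 3))) : Set (ℝ × EuclideanSpace ℝ (Fin 3))) :=
    fun _ _ => trivial
  have hcT : Continuous fun z : ℝ × EuclideanSpace ℝ (Fin 3) =>
      timeDeriv (fun s y => Real.exp s * simPull φ s y) z.1 z.2 :=
    hψt.timeDeriv_top.contDiff.continuous
  have hcL : Continuous fun z : ℝ × EuclideanSpace ℝ (Fin 3) =>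
      (Δ (fun y => Real.exp z.1 * simPull φ z.1 y)) z.2 :=
    hψt.laplacian_top.contDiff.continuous
  obtain ⟨hcg, -, hg0⟩ := hψt.continuous_gradient_field
  have hTK : ∀ z ∉ K, timeDeriv (fun s y => Real.exp s * simPull φ s y) z.1 z.2 = 0 := fun z hz =>
    IsSpaceTimeTestOn.timeDeriv_eq_zero_of_notMem hz
  have hLK : ∀ z ∉ K, (Δ (fun y => Real.exp z.1 * simPull φ z.1 y)) z.2 = 0 := fun z hz =>
    laplacian_eq_zero_of_notMem_tsupport (notMem_tsupport_slice hz)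
  have hu2 : LocallyIntegrableOn (fun z : ℝ × EuclideanSpace ℝ (Fin 3) => ‖uncurry u z‖ ^ 2)
      ((⊤ : Opens (ℝ × EuclideanSpace ℝ (Fin 3))) : Set (ℝ × EuclideanSpace ℝ (Fin 3))) volume :=
    (hS.locallyIntegrable_norm_sq hU).locallyIntegrableOn _
  -- the four pieces
  have hI1 : Integrable (fun z : ℝ × EuclideanSpace ℝ (Fin 3) => ‖uncurry u z‖ ^ 2 *
      ((timeDeriv (fun s y => Real.exp s * simPull φ s y) z.1 z.2 +
        (Δ (fun y => Real.exp z.1 * simPull φ z.1 y)) z.2) / 2)) volume :=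
    integrable_mul_of_locallyIntegrableOn
      (w := fun z => (timeDeriv (fun s y => Real.exp s * simPull φ s y) z.1 z.2 +
        (Δ (fun y => Real.exp z.1 * simPull φ z.1 y)) z.2) / 2)
      hu2 ((hcT.add hcL).div_const 2) hKc hKQ fun z hz => by
        show (timeDeriv (fun s y => Real.exp s * simPull φ s y) z.1 z.2 +
          (Δ (fun y => Real.exp z.1 * simPull φ z.1 y)) z.2) / 2 = 0
        rw [hTK z hz, hLK z hz]; ring
  have hI2 : Integrable (fun z : ℝ × EuclideanSpace ℝ (Fin 3) =>
      ⟪(fun s y => ‖u s y‖ ^ 2 • u s y) z.1 z.2,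
        (1 / 2 : ℝ) • gradient (fun y => Real.exp z.1 * simPull φ z.1 y) z.2⟫) volume :=
    integrable_inner_of_locallyIntegrableOn (u := fun s y => ‖u s y‖ ^ 2 • u s y)
      (w := fun z => (1 / 2 : ℝ) • gradient (fun y => Real.exp z.1 * simPull φ z.1 y) z.2)
      ((locallyIntegrable_norm_sq_smul hT hA hS).locallyIntegrableOn _)
      (hcg.const_smul (1 / 2 : ℝ)) hKc hKQ fun z hz => by
        show (1 / 2 : ℝ) • gradient (fun y => Real.exp z.1 * simPull φ z.1 y) z.2 = 0
        rw [hg0 z hz, smul_zero]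
  have hI3 : Integrable (fun z : ℝ × EuclideanSpace ℝ (Fin 3) => ‖uncurry u z‖ ^ 2 *
      ((1 / 2 : ℝ) * ⟪z.2, gradient (fun y => Real.exp z.1 * simPull φ z.1 y) z.2⟫)) volume :=
    integrable_mul_of_locallyIntegrableOn
      (w := fun z => (1 / 2 : ℝ) * ⟪z.2, gradient (fun y => Real.exp z.1 * simPull φ z.1 y) z.2⟫)
      hu2 (continuous_const.mul (continuous_snd.inner hcg)) hKc hKQ fun z hz => by
        show (1 / 2 : ℝ) * ⟪z.2, gradient (fun y => Real.exp z.1 * simPull φ z.1 y) z.2⟫ = 0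
        rw [hg0 z hz, inner_zero_right, mul_zero]
  have hI4 : Integrable (fun z : ℝ × EuclideanSpace ℝ (Fin 3) =>
      ⟪(fun s y => p s y • u s y) z.1 z.2,
        gradient (fun y => Real.exp z.1 * simPull φ z.1 y) z.2⟫) volume :=
    integrable_inner_of_locallyIntegrableOn (u := fun s y => p s y • u s y)
      (w := fun z => gradient (fun y => Real.exp z.1 * simPull φ z.1 y) z.2)
      ((locallyIntegrable_pressure_smul hT hA hS).locallyIntegrableOn _) hcg hKc hKQ hg0
  refine (((hI1.add hI2).sub hI3).add hI4).congr (Eventually.of_forall fun z => ?_)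
  simp only [Pi.add_apply, Pi.sub_apply, inner_smul_left, inner_smul_right, inner_sub_left,
    RCLike.conj_to_real, uncurry]
  ring

end Pieces

/-! ### The two sides of (2.5) after the change of variables -/

section Sides

variable {φ : ℝ → EuclideanSpace ℝ (Fin 3) → ℝ}

/-- **The dissipation side of (2.5) in the similarity variables**:
`∫∫ |physGradient H|² φ dx dt = ∫∫ |H|² ψ dy ds`, `ψ = eˢ φ ∘ Φ`. [cite: BradshawTsai2017AHP, §4 (proof of Thm 1.2), last paragraph] -/
theorem integral_integral_dissipation_phys
    (H : ℝ → EuclideanSpace ℝ (Fin 3) → EuclideanSpace ℝ (Fin 3) →L[ℝ] EuclideanSpace ℝ (Fin 3))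
    (hφ : IsSpaceTimeTestOn (slab (EuclideanSpace ℝ (Fin 3)) (Ioi 0) isOpen_Ioi) φ) :
    ∫ t, ∫ x, frobeniusNormSq (physGradient H t x) * φ t x =
      ∫ s, ∫ y, frobeniusNormSq (H s y) * (Real.exp s * simPull φ s y) := by
  have h0 : ∀ t ≤ (0 : ℝ), ∀ x : EuclideanSpace ℝ (Fin 3),
      frobeniusNormSq (physGradient H t x) * φ t x = 0 := fun t ht x => by
    rw [hφ.eq_zero_of_nonpos ht, mul_zero]
  calc ∫ t, ∫ x, frobeniusNormSq (physGradient H t x) * φ t x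
      = ∫ s, ∫ y, (simDensity (EuclideanSpace ℝ (Fin 3)) (s, y) : ℝ) •
          (frobeniusNormSq (physGradient H (simTime s) (Real.exp s • y)) *
            φ (simTime s) (Real.exp s • y)) :=
        integral_integral_eq_simMap (fun t x => frobeniusNormSq (physGradient H t x) * φ t x) h0
    _ = ∫ s, ∫ y, frobeniusNormSq (H s y) * (Real.exp s * simPull φ s y) := by
        refine integral_congr_ae (Eventually.of_forall fun s => ?_)
        refine integral_congr_ae (Eventually.of_forall fun y => ?_)
        show (simDensity (EuclideanSpace ℝ (Fin 3)) (s, y) : ℝ) • _ = _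
        rw [smul_eq_mul]
        exact simDensity_mul_dissipation_integrand H φ s y

/-- **The right-hand side of (2.5) in the similarity variables**:
`∫∫ [|v|²(∂ₜφ + Δφ) + (|v|² + 2π)(v·∇φ)] dx dt = ∫∫ (2·[integrand of (2.4) with ψ] − |u|²ψ) dy ds`,
`ψ = eˢ φ ∘ Φ`. [cite: BradshawTsai2017AHP, §4 (proof of Thm 1.2), last paragraph] -/
theorem integral_integral_ckn_phys
    (hφ : IsSpaceTimeTestOn (slab (EuclideanSpace ℝ (Fin 3)) (Ioi 0) isOpen_Ioi) φ)
    (u : ℝ → EuclideanSpace ℝ (Fin 3) → EuclideanSpace ℝ (Fin 3))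
    (p : ℝ → EuclideanSpace ℝ (Fin 3) → ℝ) :
    ∫ t, ∫ x, (‖physVelocity u t x‖ ^ 2 * (timeDeriv φ t x + 1 * (Δ (φ t)) x) +
        (‖physVelocity u t x‖ ^ 2 + 2 * physPressure p t x) *
          ⟪physVelocity u t x, gradient (φ t) x⟫ +
        2 * ⟪(0 : ℝ → EuclideanSpace ℝ (Fin 3) → EuclideanSpace ℝ (Fin 3)) t x,
          physVelocity u t x⟫ * φ t x) =
      ∫ s, ∫ y, (2 * (‖u s y‖ ^ 2 / 2 *
          (timeDeriv (fun s y => Real.exp s * simPull φ s y) s y +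
            (Δ (fun y => Real.exp s * simPull φ s y)) y) +
        (‖u s y‖ ^ 2 / 2 *
            ⟪u s y - y, gradient (fun y => Real.exp s * simPull φ s y) y⟫ +
          p s y * ⟪u s y, gradient (fun y => Real.exp s * simPull φ s y) y⟫)) -
        ‖u s y‖ ^ 2 * (Real.exp s * simPull φ s y)) := by
  have h0 : ∀ t ≤ (0 : ℝ), ∀ x : EuclideanSpace ℝ (Fin 3),
      ‖physVelocity u t x‖ ^ 2 * (timeDeriv φ t x + 1 * (Δ (φ t)) x) +
        (‖physVelocity u t x‖ ^ 2 + 2 * physPressure p t x) *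
          ⟪physVelocity u t x, gradient (φ t) x⟫ +
        2 * ⟪(0 : ℝ → EuclideanSpace ℝ (Fin 3) → EuclideanSpace ℝ (Fin 3)) t x,
          physVelocity u t x⟫ * φ t x = 0 := fun t ht x => by
    have hv : physVelocity u t x = 0 := by simp only [physVelocity, if_neg (not_lt.2 ht)]
    simp only [hv, norm_zero, Pi.zero_apply, inner_zero_left, mul_zero, zero_mul, add_zero,
      ne_eq, OfNat.ofNat_ne_zero, not_false_eq_true, zero_pow]
  calc ∫ t, ∫ x, (‖physVelocity u t x‖ ^ 2 * (timeDeriv φ t x + 1 * (Δ (φ t)) x) +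
        (‖physVelocity u t x‖ ^ 2 + 2 * physPressure p t x) *
          ⟪physVelocity u t x, gradient (φ t) x⟫ +
        2 * ⟪(0 : ℝ → EuclideanSpace ℝ (Fin 3) → EuclideanSpace ℝ (Fin 3)) t x,
          physVelocity u t x⟫ * φ t x)
      = ∫ s, ∫ y, (simDensity (EuclideanSpace ℝ (Fin 3)) (s, y) : ℝ) •
          (‖physVelocity u (simTime s) (Real.exp s • y)‖ ^ 2 *
              (timeDeriv φ (simTime s) (Real.exp s • y) +
                1 * (Δ (φ (simTime s))) (Real.exp s • y)) +
            (‖physVelocity u (simTime s) (Real.exp s • y)‖ ^ 2 +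
                2 * physPressure p (simTime s) (Real.exp s • y)) *
              ⟪physVelocity u (simTime s) (Real.exp s • y),
                gradient (φ (simTime s)) (Real.exp s • y)⟫ +
            2 * ⟪(0 : ℝ → EuclideanSpace ℝ (Fin 3) → EuclideanSpace ℝ (Fin 3)) (simTime s)
                (Real.exp s • y), physVelocity u (simTime s) (Real.exp s • y)⟫ *
              φ (simTime s) (Real.exp s • y)) :=
        integral_integral_eq_simMap _ h0
    _ = _ := by
        refine integral_congr_ae (Eventually.of_forall fun s => ?_)
        refine integral_congr_ae (Eventually.of_forall fun y => ?_)
        show (simDensity (EuclideanSpace ℝ (Fin 3)) (s, y) : ℝ) • _ = _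
        rw [smul_eq_mul]
        exact simDensity_mul_ckn_integrand hφ u p s y

end Sides

/-! ### The local energy inequality transported -/

/-- **[BT1] §4, last paragraph: the local energy inequality is inherited under the ansatz.** Let
`(u, p)` be a suitable periodic weak solution of the Leray system with profile `U₀` under
Assumption 2.1 (`T > 0`), and let `H` be any weak spatial gradient of `u` on `ℝ × ℝ³` (it agrees
a.e. with the one of Definition 2.2). Then the physical pair `v = physVelocity u`,
`π = physPressure p` with `∇v = physGradient H` satisfies the Caffarelli–Kohn–Nirenberg local
energy inequality (2.5) (with `ν = 1`, `f = 0`) on the slab `t > 0`: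
`2 ∫∫ |∇v|² φ ≤ ∫∫ (|v|²(∂ₜφ + Δφ) + (|v|² + 2π)(v·∇φ))` for every `φ ∈ C_c^∞((0,∞) × ℝ³)`,
`φ ≥ 0`. Proof: test (2.4) with `ψ = eˢ φ ∘ Φ ≥ 0`; after the change of variables
`(t,x) = Φ(s,y)` the two sides of (2.5) are `2∫∫|∇u|²ψ` and `∫∫ (2·[integrand of (2.4)] − |u|²ψ)`
(`integral_integral_dissipation_phys`, `integral_integral_ckn_phys`), and
`∫∫ (½|u|² + |∇u|²)ψ ≤ ∫∫ [integrand of (2.4)]` gives the claim once the integrable term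
`∫∫ |u|²ψ` is moved across (all terms are integrable: `|u|², |u|³, p u, |∇u|² ∈ L¹_loc`). [cite: BradshawTsai2017AHP, §4 (proof of Thm 1.2), last paragraph] -/
theorem IsSuitablePeriodicWeakSolution.localEnergyInequality_phys (hT : 0 < T)
    (hA : ProfileAssumption T q U₀) (hS : IsSuitablePeriodicWeakSolution T U₀ u p)
    {H : ℝ → EuclideanSpace ℝ (Fin 3) → EuclideanSpace ℝ (Fin 3) →L[ℝ] EuclideanSpace ℝ (Fin 3)}
    (hH : HasWeakSpatialGradientOn (⊤ : Opens (ℝ × EuclideanSpace ℝ (Fin 3))) u H)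
    {φ : ℝ → EuclideanSpace ℝ (Fin 3) → ℝ}
    (hφ : IsSpaceTimeTestOn (slab (EuclideanSpace ℝ (Fin 3)) (Ioi 0) isOpen_Ioi) φ)
    (hφ0 : ∀ t x, 0 ≤ φ t x) :
    2 * (1 : ℝ) * ∫ t, ∫ x, frobeniusNormSq (physGradient H t x) * φ t x ≤
      ∫ t, ∫ x, (‖physVelocity u t x‖ ^ 2 * (timeDeriv φ t x + 1 * (Δ (φ t)) x) +
        (‖physVelocity u t x‖ ^ 2 + 2 * physPressure p t x) *
          ⟪physVelocity u t x, gradient (φ t) x⟫ +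
        2 * ⟪(0 : ℝ → EuclideanSpace ℝ (Fin 3) → EuclideanSpace ℝ (Fin 3)) t x,
          physVelocity u t x⟫ * φ t x) := by
  obtain ⟨G, hG, hGL2, -, hLE⟩ := hS.weakForm
  have hU : Continuous (uncurry U₀) := hA.contDiff.continuous
  have hψt := isSpaceTimeTestOn_exp_mul_simPull hφ
  have hψ0 : ∀ s y, 0 ≤ (fun s y => Real.exp s * simPull φ s y) s y := fun s y =>
    mul_nonneg (Real.exp_pos s).le (hφ0 _ _)
  have key := hLE _ hψt hψ0
  -- the integrable pieces
  have hIW : Integrable (fun z : ℝ × EuclideanSpace ℝ (Fin 3) =>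
      ‖uncurry u z‖ ^ 2 * (Real.exp z.1 * simPull φ z.1 z.2)) volume :=
    integrable_mul_psi (hS.locallyIntegrable_norm_sq hU) hφ
  have hIF : Integrable (fun z : ℝ × EuclideanSpace ℝ (Fin 3) =>
      frobeniusNormSq (G z.1 z.2) * (Real.exp z.1 * simPull φ z.1 z.2)) volume :=
    integrable_mul_psi (locallyIntegrable_frobeniusNormSq hT hA hS hG hGL2) hφ
  have hI4 := integrable_localEnergy_integrand hT hA hS hφ
  -- `H = G` a.e.: the two dissipation integrals agree
  have hHG : ∀ᵐ z : ℝ × EuclideanSpace ℝ (Fin 3), H z.1 z.2 = G z.1 z.2 := by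
    have h := hH.ae_eq hG
    rw [Opens.coe_top, Measure.restrict_univ] at h
    filter_upwards [h] with z hz
    exact hz
  have hFH : ∫ s, ∫ y, frobeniusNormSq (H s y) * (Real.exp s * simPull φ s y) =
      ∫ s, ∫ y, frobeniusNormSq (G s y) * (Real.exp s * simPull φ s y) := by
    refine integral_integral_congr_ae_prod ?_
    filter_upwards [hHG] with z hz
    rw [hz]
  -- splitting the two sides of (2.4)
  have hkeyL : ∫ s, ∫ y, (‖u s y‖ ^ 2 / 2 + frobeniusNormSq (G s y)) *
        (Real.exp s * simPull φ s y) =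
      (1 / 2) * (∫ s, ∫ y, ‖u s y‖ ^ 2 * (Real.exp s * simPull φ s y)) +
        ∫ s, ∫ y, frobeniusNormSq (G s y) * (Real.exp s * simPull φ s y) := by
    have e : (fun s => ∫ y, (‖u s y‖ ^ 2 / 2 + frobeniusNormSq (G s y)) *
        (Real.exp s * simPull φ s y)) =
        fun s => ∫ y, ((fun z : ℝ × EuclideanSpace ℝ (Fin 3) =>
          (1 / 2 : ℝ) * (‖uncurry u z‖ ^ 2 * (Real.exp z.1 * simPull φ z.1 z.2))) (s, y) +
          (fun z : ℝ × EuclideanSpace ℝ (Fin 3) =>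
            frobeniusNormSq (G z.1 z.2) * (Real.exp z.1 * simPull φ z.1 z.2)) (s, y)) := by
      funext s
      refine integral_congr_ae (Eventually.of_forall fun y => ?_)
      simp only [uncurry]
      ring
    rw [e, integral_integral_add_prod (hIW.const_mul _) hIF]
    simp only [uncurry]
    simp_rw [integral_const_mul]
  have htargetR : ∫ s, ∫ y, (2 * (‖u s y‖ ^ 2 / 2 *
          (timeDeriv (fun s y => Real.exp s * simPull φ s y) s y +
            (Δ (fun y => Real.exp s * simPull φ s y)) y) +
        (‖u s y‖ ^ 2 / 2 *
            ⟪u s y - y, gradient (fun y => Real.exp s * simPull φ s y) y⟫ +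
          p s y * ⟪u s y, gradient (fun y => Real.exp s * simPull φ s y) y⟫)) -
        ‖u s y‖ ^ 2 * (Real.exp s * simPull φ s y)) =
      2 * (∫ s, ∫ y, (‖u s y‖ ^ 2 / 2 *
          (timeDeriv (fun s y => Real.exp s * simPull φ s y) s y +
            (Δ (fun y => Real.exp s * simPull φ s y)) y) +
        (‖u s y‖ ^ 2 / 2 *
            ⟪u s y - y, gradient (fun y => Real.exp s * simPull φ s y) y⟫ +
          p s y * ⟪u s y, gradient (fun y => Real.exp s * simPull φ s y) y⟫))) -
        ∫ s, ∫ y, ‖u s y‖ ^ 2 * (Real.exp s * simPull φ s y) := by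
    have e : (fun s => ∫ y, (2 * (‖u s y‖ ^ 2 / 2 *
          (timeDeriv (fun s y => Real.exp s * simPull φ s y) s y +
            (Δ (fun y => Real.exp s * simPull φ s y)) y) +
        (‖u s y‖ ^ 2 / 2 *
            ⟪u s y - y, gradient (fun y => Real.exp s * simPull φ s y) y⟫ +
          p s y * ⟪u s y, gradient (fun y => Real.exp s * simPull φ s y) y⟫)) -
        ‖u s y‖ ^ 2 * (Real.exp s * simPull φ s y))) =
        fun s => ∫ y, ((fun z : ℝ × EuclideanSpace ℝ (Fin 3) => 2 * (‖u z.1 z.2‖ ^ 2 / 2 *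
          (timeDeriv (fun s y => Real.exp s * simPull φ s y) z.1 z.2 +
            (Δ (fun y => Real.exp z.1 * simPull φ z.1 y)) z.2) +
        (‖u z.1 z.2‖ ^ 2 / 2 *
            ⟪u z.1 z.2 - z.2, gradient (fun y => Real.exp z.1 * simPull φ z.1 y) z.2⟫ +
          p z.1 z.2 * ⟪u z.1 z.2, gradient (fun y => Real.exp z.1 * simPull φ z.1 y) z.2⟫)))
            (s, y) -
          (fun z : ℝ × EuclideanSpace ℝ (Fin 3) =>
            ‖uncurry u z‖ ^ 2 * (Real.exp z.1 * simPull φ z.1 z.2)) (s, y)) := by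
      funext s
      rfl
    rw [e, integral_integral_sub (hI4.const_mul 2) hIW]
    simp only [uncurry]
    simp_rw [integral_const_mul]
  -- conclusion
  rw [integral_integral_dissipation_phys H hφ, integral_integral_ckn_phys hφ u p, hFH, htargetR,
    mul_one]
  rw [hkeyL] at key
  linarith

end BradshawTsai2017

end Literature.Analysis.FluidPDE

end
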